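import Literature.AlgebraicGeometry.Deformation.EquivariantPolarisedFirstOrderDeformations
import Literature.AlgebraicGeometry.Modules.TensorLinear
import Mathlib.Algebra.Homology.DerivedCategory.Ext.Linear
import Mathlib.Algebra.Homology.DerivedCategory.Ext.Map
import HarnessLib

/-!
# The obstruction map `κ ↦ (id_E ⊗ κ) ∘ At(E)` is `S`-linear; `T¹(X/S)_{L}` and `T¹(X/S)^{e}_{L}` as `S`-submodules

Layer `Literature/AlgebraicGeometry/Deformation`, namespace `Literature.AlgebraicGeometry.Deformation.FirstOrder` (continuation of
`Deformation/EquivariantPolarisedFirstOrderDeformations`, which recorded as missing: «An `S`-submodule form of `T¹(X/S)_{L}` needs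
`S`-linearity of `E ⊗ –` on morphisms for the base-`S` structure, not recorded in the tree; the additive form is what
[HuybrechtsThomas2010] states»).  That linearity is now the tree's `Modules.linear_tensorBifunctor_obj` (`Modules/TensorLinear`), so:

* §1 **`ob_E(c • κ) = c • ob_E(κ)`** for `c ∈ S` (`kodairaSpencerObstruction_smul`): in
  `ob_κ(E) = At'(E) · (≅) · (E ⊗ κ) · (unitor)` (the tree's `HodgeTheory.kodairaSpencerObstruction`, [HuybrechtsThomas2010, Cor. 3.4]
  «there is a deformation `E` of `E₀` if and only if `0 = (id_{E₀} ⊗ κ(X₀/X)) ∘ A(E₀)`») the middle factor is `S`-linear in `κ`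
  (Mathlib `Functor.mapExactFunctor_smul` for the `S`-linear exact functor `E ⊗ –`) and Yoneda composition is `S`-bilinear
  (Mathlib `Ext.comp_smul`, `Ext.smul_comp`) — exactly as the tree's `transport_smul`; bundled **`kodairaSpencerObstructionLinear hΩ hE :
  T¹(X/S) →ₗ[S] Ext²(E, E)`** (same function as `kodairaSpencerObstructionHom`);
* §2 **`polarisedSubmodule hΩ hL : Submodule S (T¹(X/S)) := ker`** — `T¹(X/S)_{L}` as an `S`-submodule, with
  `polarisedSubmodule_toAddSubgroup : _ = polarisedSubgroup hΩ hL` (same carrier as the tree's additive subgroup) and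
  `smul_mem_polarisedSubgroup`;
* §3 **`equivariantPolarisedSubmodule e hΩ hL : Submodule S (T¹(X/S)) := fixedSubmodule e ⊓ polarisedSubmodule hΩ hL`** —
  `T¹(X/S)^{e}_{L}` as an `S`-submodule (`…_toAddSubgroup : _ = equivariantPolarised e hΩ hL`), the shape the requester's interface
  asks for (`WeilTangentFamily.carrier : Submodule ℂ (T¹(S⁴/ℂ))` in `Summits/…/BlochSeedDiscOne/StaticAlongTW`; definition item
  `defn-WeilTangentFamilyConstruction`, needs (a)+(b) in submodule form).  Need (c) of that item (the dimension `n²`,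
  [vanGeemen1994HodgeAV, §5.3]) is NOT asserted here, nor is the comparison of `kodairaSpencerObstructionHom` with the problem-side
  `StaticAlongTW.obstructionMap` (different but isomorphic twisting functors `E ⊗ –` vs `𝓗om(E^∨, –)`; not in this file).

Everything is a DEFINITION with a body or a PROVED lemma; no named fact, no `sorry`, no `instance`, no notation.

## References

* D. Huybrechts, R. P. Thomas, *Deformation-obstruction theory for complexes via Atiyah and Kodaira–Spencer classes*,
  Math. Ann. 346 (2010), Cor. 3.4 (arXiv:0805.3527, p. 10). [HuybrechtsThomas2010]
* U. Görtz, T. Wedhorn, *Algebraic Geometry I: Schemes*, 2nd ed. (2020), §(7.3) (7.3.6) (the `Γ(X, 𝒪_X)`-module `Hom_{𝒪_X}(𝓕, 𝓕')`). [GortzWedhorn2020]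
* R. Hartshorne, *Algebraic Geometry*, GTM 52 (1977), II Prop. 8.11, III §6. [Hartshorne1977]
* B. van Geemen, *An introduction to the Hodge conjecture for abelian varieties*, LNM 1594 (1994), §4.9–4.10, §5.3 (context only). [vanGeemen1994HodgeAV]
-/

noncomputable section

set_option autoImplicit false

open CategoryTheory CategoryTheory.Abelian CategoryTheory.Limits AlgebraicGeometry
open AlgebraicGeometry.Scheme.Modules
open Literature.AlgebraicGeometry Literature.AlgebraicGeometry.Modules Literature.AlgebraicGeometry.Motives
open Literature.AlgebraicGeometry.HodgeTheory

namespace Literature.AlgebraicGeometry.Deformation.FirstOrder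

universe w u

/-! ## §1 `ob_E` is `S`-linear -/

section Linear

variable {S : Type u} [CommRing S] {X : Over (Spec (CommRingCat.of S))} [HasExt.{w} X.left.Modules]
  (hΩ : IsFiniteLocallyFree (cotangentSheaf X)) {E : X.left.Modules} (hE : IsFiniteLocallyFree E)

/-- **`ob_E(c • κ) = c • ob_E(κ)`** for `c ∈ S`: the obstruction class `ob_κ(E) = (id_E ⊗ κ) ∘ At(E)` («there is a deformation `E` of `E₀`
if and only if `0 = (id_{E₀} ⊗ κ(X₀/X)) ∘ A(E₀)`») is `S`-linear in the deformation direction — `E ⊗ –` is an `S`-linear exact functor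
(`Modules.linear_tensorBifunctor_obj`, Mathlib `Functor.mapExactFunctor_smul`) and Yoneda composition is `S`-bilinear (`Ext.comp_smul`,
`Ext.smul_comp`). [cite: HuybrechtsThomas2010, Cor. 3.4 (arXiv p. 10)] [cite: GortzWedhorn2020, §(7.3), (7.3.6) (the Γ(X,𝒪_X)-module structure on Hom; reading: composition is bilinear)] -/
theorem kodairaSpencerObstruction_smul (c : S) (κ : DefT1.{w} X) :
    kodairaSpencerObstruction hΩ hE (c • κ) = c • kodairaSpencerObstruction hΩ hE κ := by
  letI : ((tensorBifunctor X.left).obj E).Additive := additive_tensorBifunctor_obj E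
  letI : PreservesFiniteLimits ((tensorBifunctor X.left).obj E) :=
    preservesFiniteLimits_tensorBifunctor_obj_of_isFiniteLocallyFree hE
  letI : PreservesFiniteColimits ((tensorBifunctor X.left).obj E) := preservesFiniteColimits_tensorBifunctor_obj E
  haveI : ((tensorBifunctor X.left).obj E).Linear S := linear_tensorBifunctor_obj E
  rw [kodairaSpencerObstruction_def, kodairaSpencerObstruction_def, Functor.mapExactFunctor_smul]
  exact (congrArg (fun t => Ext.comp t (Ext.mk₀ (tensorUnitRightIso E).hom) (add_zero 2))
    (Ext.comp_smul ((atiyahClass'.{w} E).comp (Ext.mk₀ (tangentHomTensorIso hΩ E).hom) (add_zero 1))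
      (κ.mapExactFunctor ((tensorBifunctor X.left).obj E) :
        Ext.{w} (tensorObj E (cotangentSheaf X)) (tensorObj E (unitModule X.left)) 1) rfl c)).trans
    (Ext.smul_comp _ _ (add_zero 2) c)

/-- `kodairaSpencerObstructionHom hΩ hE (c • κ) = c • kodairaSpencerObstructionHom hΩ hE κ`. [cite: HuybrechtsThomas2010, Cor. 3.4 (arXiv p. 10)] -/
theorem kodairaSpencerObstructionHom_smul (c : S) (κ : DefT1.{w} X) :
    kodairaSpencerObstructionHom hΩ hE (c • κ) = c • kodairaSpencerObstructionHom hΩ hE κ :=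
  kodairaSpencerObstruction_smul hΩ hE c κ

/-- **`ob_E : T¹(X/S) →ₗ[S] Ext²(E, E)`** — the tree's obstruction homomorphism `κ ↦ (id_E ⊗ κ) ∘ At(E)` (`kodairaSpencerObstructionHom`,
«there is a deformation `E` of `E₀` if and only if `0 = (id_{E₀} ⊗ κ(X₀/X)) ∘ A(E₀)`») as an `S`-LINEAR map (`kodairaSpencerObstruction_smul`).
[cite: HuybrechtsThomas2010, Cor. 3.4 (arXiv p. 10)] -/
def kodairaSpencerObstructionLinear : DefT1.{w} X →ₗ[S] Ext.{w} E E 2 where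
  toFun := kodairaSpencerObstruction hΩ hE
  map_add' := kodairaSpencerObstruction_add hΩ hE
  map_smul' c κ := kodairaSpencerObstruction_smul hΩ hE c κ

/-- `kodairaSpencerObstructionLinear hΩ hE κ = kodairaSpencerObstruction hΩ hE κ`. [cite: HuybrechtsThomas2010, Cor. 3.4 (arXiv p. 10)] -/
@[simp] lemma kodairaSpencerObstructionLinear_apply (κ : DefT1.{w} X) :
    kodairaSpencerObstructionLinear hΩ hE κ = kodairaSpencerObstruction hΩ hE κ := rfl

/-- the linear map has the tree's additive obstruction homomorphism as underlying `→+`. [cite: HuybrechtsThomas2010, Cor. 3.4 (arXiv p. 10)] -/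
lemma kodairaSpencerObstructionLinear_toAddMonoidHom :
    (kodairaSpencerObstructionLinear hΩ hE).toAddMonoidHom = kodairaSpencerObstructionHom hΩ hE := rfl

end Linear

/-! ## §2 `T¹(X/S)_{L}` as an `S`-submodule -/

section Polarised

variable {S : Type u} [CommRing S] {X : Over (Spec (CommRingCat.of S))} [HasExt.{w} X.left.Modules]
  (hΩ : IsFiniteLocallyFree (cotangentSheaf X)) {L : X.left.Modules} (hL : IsFiniteLocallyFree L)

/-- **`T¹(X/S)_{L} := ker ob_L` as an `S`-SUBMODULE** — the first-order deformation classes along which `L` extends («`κ` preserves `L` to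
first order», `(id_L ⊗ κ) ∘ At(L) = 0`); same carrier as the tree's additive `polarisedSubgroup hΩ hL` (`polarisedSubmodule_toAddSubgroup`).
[cite: HuybrechtsThomas2010, Cor. 3.4 (arXiv p. 10)] -/
def polarisedSubmodule : Submodule S (DefT1.{w} X) := LinearMap.ker (kodairaSpencerObstructionLinear hΩ hL)

/-- membership: `κ ∈ T¹(X/S)_{L} ↔ ob_κ(L) = 0`. [cite: HuybrechtsThomas2010, Cor. 3.4 (arXiv p. 10)] -/
lemma mem_polarisedSubmodule_iff (κ : DefT1.{w} X) :
    κ ∈ polarisedSubmodule hΩ hL ↔ kodairaSpencerObstruction hΩ hL κ = 0 := LinearMap.mem_ker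

/-- **the `S`-submodule `T¹(X/S)_{L}` has the tree's `polarisedSubgroup hΩ hL` as underlying additive subgroup.**
[cite: HuybrechtsThomas2010, Cor. 3.4 (arXiv p. 10)] -/
lemma polarisedSubmodule_toAddSubgroup : (polarisedSubmodule hΩ hL).toAddSubgroup = polarisedSubgroup hΩ hL :=
  AddSubgroup.ext fun κ => by
    rw [Submodule.mem_toAddSubgroup, mem_polarisedSubmodule_iff, mem_polarisedSubgroup_iff]

/-- `κ ∈ polarisedSubmodule ↔ κ ∈ polarisedSubgroup`. [cite: HuybrechtsThomas2010, Cor. 3.4 (arXiv p. 10)] -/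
lemma mem_polarisedSubmodule_iff_mem_polarisedSubgroup (κ : DefT1.{w} X) :
    κ ∈ polarisedSubmodule hΩ hL ↔ κ ∈ polarisedSubgroup hΩ hL := by
  rw [mem_polarisedSubmodule_iff, mem_polarisedSubgroup_iff]

/-- same carrier set. [cite: HuybrechtsThomas2010, Cor. 3.4 (arXiv p. 10)] -/
lemma coe_polarisedSubmodule :
    (polarisedSubmodule hΩ hL : Set (DefT1.{w} X)) = (polarisedSubgroup hΩ hL : Set (DefT1.{w} X)) :=
  Set.ext fun κ => mem_polarisedSubmodule_iff_mem_polarisedSubgroup hΩ hL κ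

/-- **`T¹(X/S)_{L}` is stable under the scalars of `S`**: `ob_L(κ) = 0 ⇒ ob_L(c • κ) = 0`. [cite: HuybrechtsThomas2010, Cor. 3.4 (arXiv p. 10)] -/
lemma smul_mem_polarisedSubgroup (c : S) {κ : DefT1.{w} X} (hκ : κ ∈ polarisedSubgroup hΩ hL) :
    c • κ ∈ polarisedSubgroup hΩ hL :=
  (mem_polarisedSubmodule_iff_mem_polarisedSubgroup hΩ hL _).1
    ((polarisedSubmodule hΩ hL).smul_mem c ((mem_polarisedSubmodule_iff_mem_polarisedSubgroup hΩ hL κ).2 hκ))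

/-- if `Ext²(L, L)` is subsingleton every class preserves `L`: `T¹(X/S)_{L} = ⊤`. [cite: HuybrechtsThomas2010, Cor. 3.4 (arXiv p. 10)] -/
lemma polarisedSubmodule_eq_top_of_subsingleton [Subsingleton (Ext.{w} L L 2)] : polarisedSubmodule hΩ hL = ⊤ :=
  Submodule.eq_top_iff'.2 fun _ => (mem_polarisedSubmodule_iff hΩ hL _).2 (Subsingleton.elim _ _)

end Polarised

/-! ## §3 `T¹(X/S)^{e}_{L}` as an `S`-submodule -/

section EquivariantPolarised

variable {S : Type u} [CommRing S] {X : Over (Spec (CommRingCat.of S))} (e : X ≅ X) [HasExt.{w} X.left.Modules]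
  (hΩ : IsFiniteLocallyFree (cotangentSheaf X)) {L : X.left.Modules} (hL : IsFiniteLocallyFree L)

/-- **`T¹(X/S)^{e}_{L} = T¹(X/S)^{e} ⊓ T¹(X/S)_{L}` as an `S`-SUBMODULE** — the `e`-invariant first-order deformations of the polarised
scheme `(X, L)` (classes with `e • κ = κ` along which `L` extends); same carrier as the tree's additive `equivariantPolarised e hΩ hL`
(`equivariantPolarisedSubmodule_toAddSubgroup`).  This is the shape `Submodule S (T¹(X/S))` of the requester's interface; the intended
reading (`X/ℂ` an abelian variety of Weil type with `e = ψ`, `L` the polarisation: the tangent space to the `n²`-dimensional Weil family)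
and its dimension are NOT asserted here. [cite: HuybrechtsThomas2010, Cor. 3.4 (arXiv p. 10)] [cite: vanGeemen1994HodgeAV, §4.9–4.10 and §5.3 (polarized abelian varieties of Weil type lie in n²-dimensional families; reading, context only)] -/
def equivariantPolarisedSubmodule : Submodule S (DefT1.{w} X) := fixedSubmodule e ⊓ polarisedSubmodule hΩ hL

/-- membership: `κ ∈ T¹(X/S)^{e}_{L} ↔ e • κ = κ ∧ ob_κ(L) = 0`. [cite: HuybrechtsThomas2010, Cor. 3.4 (arXiv p. 10)] -/
lemma mem_equivariantPolarisedSubmodule_iff (κ : DefT1.{w} X) :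
    κ ∈ equivariantPolarisedSubmodule e hΩ hL ↔ transport e κ = κ ∧ kodairaSpencerObstruction hΩ hL κ = 0 := by
  rw [equivariantPolarisedSubmodule, Submodule.mem_inf, mem_fixedSubmodule_iff, mem_polarisedSubmodule_iff]

/-- `κ ∈ equivariantPolarisedSubmodule ↔ κ ∈ equivariantPolarised`. [cite: HuybrechtsThomas2010, Cor. 3.4 (arXiv p. 10)] -/
lemma mem_equivariantPolarisedSubmodule_iff_mem_equivariantPolarised (κ : DefT1.{w} X) :
    κ ∈ equivariantPolarisedSubmodule e hΩ hL ↔ κ ∈ equivariantPolarised e hΩ hL := by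
  rw [mem_equivariantPolarisedSubmodule_iff, mem_equivariantPolarised_iff]

/-- **the `S`-submodule `T¹(X/S)^{e}_{L}` has the tree's `equivariantPolarised e hΩ hL` as underlying additive subgroup.**
[cite: HuybrechtsThomas2010, Cor. 3.4 (arXiv p. 10)] -/
lemma equivariantPolarisedSubmodule_toAddSubgroup :
    (equivariantPolarisedSubmodule e hΩ hL).toAddSubgroup = equivariantPolarised e hΩ hL :=
  AddSubgroup.ext fun κ => by
    rw [Submodule.mem_toAddSubgroup, mem_equivariantPolarisedSubmodule_iff_mem_equivariantPolarised]

/-- same carrier set. [cite: HuybrechtsThomas2010, Cor. 3.4 (arXiv p. 10)] -/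
lemma coe_equivariantPolarisedSubmodule :
    (equivariantPolarisedSubmodule e hΩ hL : Set (DefT1.{w} X)) = (equivariantPolarised e hΩ hL : Set (DefT1.{w} X)) :=
  Set.ext fun κ => mem_equivariantPolarisedSubmodule_iff_mem_equivariantPolarised e hΩ hL κ

/-- `T¹(X/S)^{e}_{L} ≤ T¹(X/S)^{e}`. [cite: Hartshorne1977, II Prop. 8.11 and III §6] -/
lemma equivariantPolarisedSubmodule_le_fixedSubmodule : equivariantPolarisedSubmodule e hΩ hL ≤ fixedSubmodule e := inf_le_left

/-- `T¹(X/S)^{e}_{L} ≤ T¹(X/S)_{L}`. [cite: HuybrechtsThomas2010, Cor. 3.4 (arXiv p. 10)] -/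
lemma equivariantPolarisedSubmodule_le_polarisedSubmodule :
    equivariantPolarisedSubmodule e hΩ hL ≤ polarisedSubmodule hΩ hL := inf_le_right

/-- `L` is first-order unobstructed along `T¹(X/S)^{e}_{L}`: `∀ κ ∈ T¹(X/S)^{e}_{L}, ob_κ(L) = 0`. [cite: HuybrechtsThomas2010, Cor. 3.4 (arXiv p. 10)] -/
lemma kodairaSpencerObstruction_eq_zero_of_mem_equivariantPolarisedSubmodule {κ : DefT1.{w} X}
    (hκ : κ ∈ equivariantPolarisedSubmodule e hΩ hL) : kodairaSpencerObstruction hΩ hL κ = 0 :=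
  ((mem_equivariantPolarisedSubmodule_iff e hΩ hL κ).1 hκ).2

/-- every class of `T¹(X/S)^{e}_{L}` is fixed by `e`. [cite: Hartshorne1977, II Prop. 8.11 and III §6] -/
lemma transport_eq_self_of_mem_equivariantPolarisedSubmodule {κ : DefT1.{w} X}
    (hκ : κ ∈ equivariantPolarisedSubmodule e hΩ hL) : transport e κ = κ :=
  ((mem_equivariantPolarisedSubmodule_iff e hΩ hL κ).1 hκ).1

/-- **`T¹(X/S)^{e}_{L}` (additive form) is stable under the scalars of `S`.** [cite: HuybrechtsThomas2010, Cor. 3.4 (arXiv p. 10)] -/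
lemma smul_mem_equivariantPolarised (c : S) {κ : DefT1.{w} X} (hκ : κ ∈ equivariantPolarised e hΩ hL) :
    c • κ ∈ equivariantPolarised e hΩ hL :=
  (mem_equivariantPolarisedSubmodule_iff_mem_equivariantPolarised e hΩ hL _).1
    ((equivariantPolarisedSubmodule e hΩ hL).smul_mem c
      ((mem_equivariantPolarisedSubmodule_iff_mem_equivariantPolarised e hΩ hL κ).2 hκ))

end EquivariantPolarised

end Literature.AlgebraicGeometry.Deformation.FirstOrder

end
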